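import Literature.Analysis.UnboundedOperators.LinearMildWindows
import HarnessLib

/-!
# The linearised mild equation along a continuous curve: uniqueness and the identity from interior windows

Analysis/UnboundedOperators support file (everything proved; no definitions, no named facts): the case
`B(s) = N(Y(s), ·) + N(·, Y(s))` of `LinearMildUniqueness.lean` and `LinearMildWindows.lean`, i.e. the
LINEARISATION of the semilinear mild equation `y = T y₀ + ∫ T f − ∫ K N(y, y)` along a continuous curve `Y`
(D. Henry, *Geometric Theory of Semilinear Parabolic Equations*, LNM 840 (1981), Cor. 3.4.6: the derivative
of the mild flow in the datum solves `z(t) = T(t) h − ∫₀ᵗ K(t − s) (N(Y(s), z(s)) + N(z(s), Y(s))) ds`).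
The coefficient operators `B(s) = N(Y(s), ·) + N(·, Y(s))` are bounded by `2 ‖N‖ sup ‖Y‖` on the compact
time interval and the sources `s ↦ B(s) z(s)` are continuous when `Y` and `z` are, so the general statements
specialise; consumers working in a concrete Hilbert space only ever see `N`, `Y` and the curves (no operator
norms of coefficient families):

* `linearisedMild_unique` — two solutions from the same datum, continuous on `[0, L']`, coincide;
* `linearisedMild_of_forall_window` — a curve continuous on `[0, τ]` solving the equation on every interior
  window `[ε, τ]` from its own value `Z(ε)` solves it from the origin.

## References

* D. Henry, *Geometric Theory of Semilinear Parabolic Equations*, LNM 840, Springer (1981), Lemma 3.3.2,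
  Thm. 3.3.3, Cor. 3.4.6, Lemma 7.1.1. [Henry1981]
-/

noncomputable section

open Set Filter MeasureTheory intervalIntegral
open _root_.Topology

namespace Literature.Analysis.UnboundedOperators

variable {E : Type*} [NormedAddCommGroup E] [NormedSpace ℝ E]

/-- The coefficient operators `B(s) = N(Y(s), ·) + N(·, Y(s))` of the linearisation along a curve `Y`
continuous on `[0, L]`: their action, a uniform bound `‖B(s)‖ ≤ β` on `[0, L]`, and the continuity of the
source `s ↦ B(s) z(s)` for every `z` continuous on `[0, L]`. [folklore] -/
theorem exists_coeff_of_continuousOn (N : E →L[ℝ] E →L[ℝ] E) {L : ℝ} {Y : ℝ → E} (hY : ContinuousOn Y (Icc 0 L)) :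
    ∃ (B : ℝ → E →L[ℝ] E) (β : ℝ), (∀ (s : ℝ) (v : E), B s v = N (Y s) v + N v (Y s)) ∧
      (∀ s ∈ Icc 0 L, ‖B s‖ ≤ β) ∧
      ∀ z : ℝ → E, ContinuousOn z (Icc 0 L) → ContinuousOn (fun s => B s (z s)) (Icc 0 L) := by
  obtain ⟨M, hM⟩ := (isCompact_Icc.image_of_continuousOn hY).isBounded.exists_norm_le
  have hM' : ∀ s ∈ Icc (0 : ℝ) L, ‖Y s‖ ≤ M := fun s hs => hM _ (mem_image_of_mem _ hs)
  refine ⟨fun s => N (Y s) + N.flip (Y s), ‖N‖ * M + ‖N‖ * M, fun s v => by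
    simp only [add_apply, ContinuousLinearMap.flip_apply], fun s hs => ?_, fun z hz => ?_⟩
  · refine (norm_add_le _ _).trans (add_le_add ?_ ?_)
    · exact (N.le_opNorm _).trans (mul_le_mul_of_nonneg_left (hM' s hs) (norm_nonneg _))
    · rw [← N.opNorm_flip]
      exact (N.flip.le_opNorm _).trans (mul_le_mul_of_nonneg_left (hM' s hs) (norm_nonneg _))
  · have hN2 : Continuous fun p : E × E => N p.1 p.2 := N.continuous₂
    have h1 : ContinuousOn (fun s => N (Y s) (z s)) (Icc 0 L) := hN2.comp_continuousOn (hY.prodMk hz)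
    have h2 : ContinuousOn (fun s => N (z s) (Y s)) (Icc 0 L) := hN2.comp_continuousOn (hz.prodMk hY)
    exact (h1.add h2).congr fun s _ => by
      simp only [add_apply, ContinuousLinearMap.flip_apply, Pi.add_apply]

/-- **Uniqueness for the linearised mild equation along a continuous curve** (Henry 1981, Cor. 3.4.6 with
Lemma 7.1.1): for contractions `T(t)`, a weakly singular strongly continuous family `K`, a bounded bilinear
`N` and a curve `Y` continuous on `[0, L']`, two solutions of
`z(t) = T(t) x − ∫₀ᵗ K(t − s) (N(Y(s), z(s)) + N(z(s), Y(s))) ds` that are continuous on `[0, L']` coincide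
there (`linearMild_unique` with `B(s) = N(Y(s), ·) + N(·, Y(s))`). [cite: Henry1981, Cor. 3.4.6] -/
theorem linearisedMild_unique (T K : ℝ → E →L[ℝ] E) (hTnorm : ∀ t, 0 ≤ t → ‖T t‖ ≤ 1)
    {α C : ℝ} (hα : α < 1) (hC : 0 ≤ C) (hK : ∀ t, 0 < t → ‖K t‖ ≤ C * t ^ (-α))
    (hKc : ∀ y : E, ContinuousOn (fun t : ℝ => K t y) (Ioi 0)) (N : E →L[ℝ] E →L[ℝ] E) {L' : ℝ} {Y : ℝ → E}
    (hY : ContinuousOn Y (Icc 0 L')) {x : E} {z z' : ℝ → E} (hz : ContinuousOn z (Icc 0 L'))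
    (hz' : ContinuousOn z' (Icc 0 L'))
    (hZ : ∀ t ∈ Icc 0 L', z t = T t x - ∫ s in (0 : ℝ)..t, K (t - s) (N (Y s) (z s) + N (z s) (Y s)))
    (hZ' : ∀ t ∈ Icc 0 L', z' t = T t x - ∫ s in (0 : ℝ)..t, K (t - s) (N (Y s) (z' s) + N (z' s) (Y s))) :
    EqOn z z' (Icc 0 L') := by
  obtain ⟨B, β, hBapp, hB, hsrc⟩ := exists_coeff_of_continuousOn N hY
  exact linearMild_unique T K hTnorm hα hC hK hKc B hB hz hz' (hsrc z hz) (hsrc z' hz')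
    (fun t ht => by simp only [hBapp]; exact hZ t ht) (fun t ht => by simp only [hBapp]; exact hZ' t ht)

/-- **The linearised mild identity from the origin out of the identities on all interior windows** (Henry
1981, Lemma 3.3.2 / Cor. 3.4.6): for strongly continuous contractions `T(t)` with `T(0) = 1`, a weakly
singular strongly continuous `K`, a bounded bilinear `N` and curves `Y`, `Z` continuous on `[0, τ]`, if for
every `0 < ε < τ` and `t ∈ [0, τ − ε]`,
`Z(ε + t) = T(t) Z(ε) − ∫₀ᵗ K(t − s) (N(Y(ε + s), Z(ε + s)) + N(Z(ε + s), Y(ε + s))) ds`, then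
`Z(t) = T(t) Z(0) − ∫₀ᵗ K(t − s) (N(Y(s), Z(s)) + N(Z(s), Y(s))) ds` on `[0, τ]`
(`linearMild_of_forall_window` with `B(s) = N(Y(s), ·) + N(·, Y(s))`). [cite: Henry1981, Lemma 3.3.2 and Cor. 3.4.6] -/
theorem linearisedMild_of_forall_window (T K : ℝ → E →L[ℝ] E) (hT0 : T 0 = 1)
    (hTnorm : ∀ t, 0 ≤ t → ‖T t‖ ≤ 1) (hTc : ∀ y : E, Continuous fun t : ℝ => T t y)
    {α C : ℝ} (hα : α < 1) (hK : ∀ t, 0 < t → ‖K t‖ ≤ C * t ^ (-α))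
    (hKc : ∀ y : E, ContinuousOn (fun t : ℝ => K t y) (Ioi 0)) (N : E →L[ℝ] E →L[ℝ] E) {τ : ℝ} {Y Z : ℝ → E}
    (hY : ContinuousOn Y (Icc 0 τ)) (hZ : ContinuousOn Z (Icc 0 τ))
    (hwin : ∀ ε : ℝ, 0 < ε → ε < τ → ∀ t ∈ Icc 0 (τ - ε), Z (ε + t) = T t (Z ε) -
      ∫ s in (0 : ℝ)..t, K (t - s) (N (Y (ε + s)) (Z (ε + s)) + N (Z (ε + s)) (Y (ε + s)))) :
    ∀ t ∈ Icc 0 τ, Z t = T t (Z 0) - ∫ s in (0 : ℝ)..t, K (t - s) (N (Y s) (Z s) + N (Z s) (Y s)) := by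
  obtain ⟨B, β, hBapp, -, hsrc⟩ := exists_coeff_of_continuousOn N hY
  have h := linearMild_of_forall_window T K hT0 hTnorm hTc hα hK hKc B hZ (hsrc Z hZ)
    (fun ε hε hετ t ht => by simp only [hBapp]; exact hwin ε hε hετ t ht)
  intro t ht
  have e := h t ht
  simp only [hBapp] at e
  exact e

end Literature.Analysis.UnboundedOperators

end
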